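import Summits.Ventures.YMGap.RobustBall.TorusRange
import Summits.Ventures.YMGap.Thresholds.StarAdjacency
import HarnessLib

/-!
# Venture YMGap, track ROBUST-BALL (Y2) — the robust TORUS Dobrushin door (targets U3 and U3-W of
`RobustBall/Targets`)

HONEST FRAMING. WHAT THIS IS: a venture file (cell `pub-ymgap`, track Y2 ROBUST-BALL, seat ds-2): the
SINGLE-LINK DOBRUSHIN DOOR ON THE TORUS, UNIFORM ON THE BALL. For the perturbed `SU(N)` torus action
`β S_W + W` at tree coupling `β` (`perturbedTorusSpec W β`, `W` a quasi-local gauge-invariant perturbation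
with a `LoadWitness w`) and ANY one-link Kantorovich–Rubinstein modulus `OneLinkKRModulus N R K` on the
radius `R ≥ (|β|/N)·2(d−1)` of the torus link fields, Dobrushin's condition in the Vasserstein form holds
with the ROBUST DOBRUSHIN MATRIX
`C_W(e,y) = K e^{a(e)} (1 + 2√N ℓ_s(e)) · (|β|/N) n(e,y) + √N · ℓ(e,y)`
(`a = oscLoad 0`, `ℓ_s = selfLipLoad 0`, `ℓ(e,y) = crossLip 0 e y`, `n = tInfluence`): the Wilson entry
transferred through the re-weighting by ds-4's `su_oneLink_transfer` (U1) plus the Grüss cross leg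
`su_abs_integral_tilt_sub_tilt_le` (U2) — together `su_oneLink_robust_influence`. Row sums:
`∑_{y ≠ e} C_W(e,y) ≤ K e^{a(e)}(1 + 2√N ℓ_s(e)) (|β|/N) 6(d−1) + √N Λ(e)`, and with the weight
`e^{t‖e−y‖_∞}`, `t ≥ 0`: `≤ e^{t} · (Wilson part) + √N Λ_t(e)` (plaquette neighbours sit at distance `≤ 1`,
two links of a polymer `X` at distance `≤ diam X`). On the ball (`a ≤ ε₀`, `ℓ_s + Λ ≤ ε₁`, per link) both are
`≤ rhoFR N c_W ε₀ ε₁` by the vertex bound (`row_le_rhoFR`), `c_W = K(|β|/N)6(d−1)` resp. `e^{κ} K(|β|/N)6(d−1)`.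
Hence `robustTorusDoorTarget_holds : RobustTorusDoorTarget N d β ε₀ ε₁ R K r` (tier 1, neighbourhoods of
range `≤ r ⊔ 1`) and `robustTorusDoorWTarget_holds : RobustTorusDoorWTarget N d β κ ε₀ ε₁ R K` (tier 2,
all links as neighbours, weighted rows) for every `d ≥ 1`, `N ≥ 1`.
WHAT THIS IS NOT: no clustering / covariance statement (`TorusClustering`), no number, no row certified; the
modulus is a HYPOTHESIS BY NAME (the tree's quarter modulus / Bakry–Émery / variance doors instantiate it);
strong-coupling LATTICE bookkeeping on finite tori — no continuum statement, no Millennium claim.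

## References
* R. L. Dobrushin, Theory Probab. Appl. 15 (1970) 458; H. Föllmer, LNM 1362 (1988) Ch. I (2.7), (2.20).
* H. Shen, R. Zhu, X. Zhu, CMP 400 (2023) 805, remark after Rem. 1.3 (the Wilson Dobrushin matrix).
* The tree: `StrongCouplingTorusWindow.lean` (`isKRContraction_torusWilson`, the `W = 0` template;
  `frobNorm_tField_sub_le`, `matrixOpNorm_tField_le`, `sum_tInfluence_le`), ds-4's
  `Thresholds/OneLinkTiltStability.lean` (`su_oneLink_robust_influence`), p3's `Thresholds/StarAdjacency.lean`
  (`tInfluence_eq_jointPlaq`), rb-p1's `RobustBall/RobustMassGapDoor.lean` (the `ℤ^d` twin).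
-/

noncomputable section

open MeasureTheory ProbabilityTheory Finset Function Real
open Literature.Probability.LatticeModels Literature.Probability.LatticeModels.DobrushinMetric
open Literature.MathematicalPhysics.QuantumLattice hiding torusNorm
open Literature.MathematicalPhysics.QuantumFieldTheory hiding ZdEdge
open Literature.MathematicalPhysics.QuantumFieldTheory.Balaban1983to89.StrongCouplingTorusWindow
open Literature.MathematicalPhysics.QuantumFieldTheory.Balaban1983to89.StrongCouplingDobrushinWindow
  (OneLinkKRModulus)

namespace Summit.Ventures.YMGap.RobustBall

variable {d L N : ℕ} [NeZero L]

/-! ### The robust Dobrushin entry at `(e, y)` -/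

section Entry

variable {W : Perturbation d L N}

/-- **The robust Dobrushin entry.** For boundary conditions `ω = η` off a link `y ≠ e`, a bounded measurable
`Lφ`-Lipschitz test function `φ` and a modulus `OneLinkKRModulus N R K` on the radius of the torus link fields,
`|γ^{W,β}_e(φ | ω) − γ^{W,β}_e(φ | η)| ≤ (K e^{a(e)} (1 + 2√N ℓ_s(e)) (|β|/N) n(e,y) + √N ℓ(e,y)) · Lφ · ‖ω_y − η_y‖_F`
— U0 (`siteLaw_perturbedTorusSpec_thooft`), U0′ (the loads) and ds-4's `su_oneLink_robust_influence` (U1 + U2)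
with `‖B_ω − B_η‖_F ≤ (|β|/N) n(e,y) ‖ω_y − η_y‖_F`. [folklore] -/
theorem abs_integral_siteLaw_sub_le (hd : 1 ≤ d) (hN : 1 ≤ N) (hL : 1 < L) {β R K : ℝ} (hK : 0 ≤ K)
    (hR : |β| / N * (2 * ((d : ℝ) - 1)) ≤ R) (hmod : OneLinkKRModulus N R K) (w : LoadWitness W)
    {e y : Edge d L} (hye : y ≠ e) {ω η : GaugeConfig d L (SUN N)} (hωη : ∀ z, z ≠ y → ω z = η z)
    (φ : SUN N → ℝ) (Lφ : ℝ) (hφm : Measurable φ) (hφb : ∃ M, ∀ s, |φ s| ≤ M) (hLφ : 0 ≤ Lφ)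
    (hφL : ∀ a b, |φ a - φ b| ≤ Lφ * suFrobDist a b) :
    |∫ s, φ s ∂(siteLaw (perturbedTorusSpec W β) e ω) - ∫ s, φ s ∂(siteLaw (perturbedTorusSpec W β) e η)| ≤
      (K * Real.exp (w.oscLoad 0 e) * (1 + 2 * Real.sqrt N * w.selfLipLoad 0 e) * (|β| / N) * tInfluence e y +
        Real.sqrt N * w.crossLip 0 e y) * Lφ * suFrobDist (ω y) (η y) := by
  rw [siteLaw_perturbedTorusSpec_thooft W β hL hN e ω, siteLaw_perturbedTorusSpec_thooft W β hL hN e η]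
  obtain ⟨M, hM⟩ := exists_abs_localTilt_le W e
  have key := OneLinkTiltStability.su_oneLink_robust_influence (N := N) (δ := w.oscLoad 0 e)
    (ℓ := w.selfLipLoad 0 e) (s := w.crossLip 0 e y * suFrobDist (ω y) (η y)) (selfLipLoad_nonneg w 0 e) hmod
    (tField β e ω) (tField β e η) ((matrixOpNorm_tField_le hd hN β e ω).trans hR)
    ((matrixOpNorm_tField_le hd hN β e η).trans hR) (localTilt W e ω) (localTilt W e η)
    (measurable_localTilt W e ω) (measurable_localTilt W e η) ⟨M, hM η⟩
    (fun g g' => localTilt_sub_le_oscLoad w e ω g g') (fun g g' => abs_localTilt_sub_le_selfLipLoad w e ω g g')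
    (fun g => abs_localTilt_sub_localTilt_le_crossLip w hye hωη g) φ Lφ hφm hφb hLφ hφL
  refine key.trans ?_
  have hT : 0 ≤ K * Real.exp (w.oscLoad 0 e) * (1 + 2 * Real.sqrt N * w.selfLipLoad 0 e) :=
    mul_nonneg (mul_nonneg hK (Real.exp_pos _).le)
      (add_nonneg zero_le_one (mul_nonneg (by positivity) (selfLipLoad_nonneg w 0 e)))
  have hB := frobNorm_tField_sub_le hL β e y hωη
  have hd0 : 0 ≤ suFrobDist (ω y) (η y) := suFrobDist_nonneg _ _
  calc (K * Real.exp (w.oscLoad 0 e) * (1 + 2 * Real.sqrt N * w.selfLipLoad 0 e) *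
          frobNorm (tField β e ω - tField β e η) + Real.sqrt N * (w.crossLip 0 e y * suFrobDist (ω y) (η y))) * Lφ
      ≤ (K * Real.exp (w.oscLoad 0 e) * (1 + 2 * Real.sqrt N * w.selfLipLoad 0 e) *
          (|β| / N * tInfluence e y * suFrobDist (ω y) (η y)) +
          Real.sqrt N * (w.crossLip 0 e y * suFrobDist (ω y) (η y))) * Lφ :=
        mul_le_mul_of_nonneg_right (add_le_add (mul_le_mul_of_nonneg_left hB hT) le_rfl) hLφ
    _ = _ := by ring

end Entry

/-! ### Dobrushin's condition in the Vasserstein form for the member -/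

section Door

variable {W : Perturbation d L N}

/-- The robust Dobrushin entries are nonnegative. [folklore] -/
theorem robustEntry_nonneg {K : ℝ} (hK : 0 ≤ K) (β : ℝ) (w : LoadWitness W) (e y : Edge d L) :
    0 ≤ K * Real.exp (w.oscLoad 0 e) * (1 + 2 * Real.sqrt N * w.selfLipLoad 0 e) * (|β| / N) * tInfluence e y +
        Real.sqrt N * w.crossLip 0 e y :=
  add_nonneg (mul_nonneg (mul_nonneg (mul_nonneg (mul_nonneg hK (Real.exp_pos _).le)
    (add_nonneg zero_le_one (mul_nonneg (by positivity) (selfLipLoad_nonneg w 0 e)))) (by positivity))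
    (Nat.cast_nonneg _)) (mul_nonneg (Real.sqrt_nonneg _) (crossLip_nonneg w 0 e y))

/-- **Dobrushin's condition (Vasserstein form) for the member, ALL links as neighbours** (tier 2; also the
starting point of tier 1): `IsKRContraction (perturbedTorusSpec W β) suFrobDist (univ ∖ {e}) C_W`. [folklore] -/
theorem isKRContraction_perturbedTorusSpec (hd : 1 ≤ d) (hN : 1 ≤ N) (hL : 1 < L) {β R K : ℝ} (hK : 0 ≤ K)
    (hR : |β| / N * (2 * ((d : ℝ) - 1)) ≤ R) (hmod : OneLinkKRModulus N R K) (w : LoadWitness W) :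
    IsKRContraction (perturbedTorusSpec W β) suFrobDist (fun e => univ.erase e) fun e y =>
      K * Real.exp (w.oscLoad 0 e) * (1 + 2 * Real.sqrt N * w.selfLipLoad 0 e) * (|β| / N) * tInfluence e y +
        Real.sqrt N * w.crossLip 0 e y := by
  refine ⟨fun e => Finset.notMem_erase e _, fun e y => robustEntry_nonneg hK β w e y,
    fun e η η' h => siteLaw_perturbedTorusSpec_congr_off β e fun z hz =>
      h z (Finset.mem_erase.2 ⟨hz, Finset.mem_univ _⟩),
    fun e y hy ω η hωη φ L' hφm hφb hL' hφL => ?_⟩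
  exact abs_integral_siteLaw_sub_le hd hN hL hK hR hmod w (Finset.mem_erase.1 hy).1 hωη φ L' hφm hφb hL' hφL

/-- **Dobrushin's condition for a tier-1 member, neighbourhoods of range `r ⊔ 1`**: under `HasRange r W` the same
matrix is a KR contraction over `nbr e = {y ≠ e : ‖e − y‖_∞ ≤ r ⊔ 1}`. [folklore] -/
theorem isKRContraction_perturbedTorusSpec_of_hasRange (hd : 1 ≤ d) (hN : 1 ≤ N) (hL : 1 < L) {β R K : ℝ}
    (hK : 0 ≤ K) (hR : |β| / N * (2 * ((d : ℝ) - 1)) ≤ R) (hmod : OneLinkKRModulus N R K) (w : LoadWitness W)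
    {r : ℕ} (hr : HasRange r W) :
    IsKRContraction (perturbedTorusSpec W β) suFrobDist
      (fun e => (univ.erase e).filter fun y => torusNorm (e.1 - y.1) ≤ max r 1) fun e y =>
      K * Real.exp (w.oscLoad 0 e) * (1 + 2 * Real.sqrt N * w.selfLipLoad 0 e) * (|β| / N) * tInfluence e y +
        Real.sqrt N * w.crossLip 0 e y := by
  refine ⟨fun e h => Finset.notMem_erase e _ (Finset.mem_filter.1 h).1, fun e y => robustEntry_nonneg hK β w e y,
    fun e η η' h => siteLaw_perturbedTorusSpec_congr_of_hasRange β hr e h,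
    fun e y hy ω η hωη φ L' hφm hφb hL' hφL => ?_⟩
  exact abs_integral_siteLaw_sub_le hd hN hL hK hR hmod w (Finset.mem_erase.1 (Finset.mem_filter.1 hy).1).1 hωη
    φ L' hφm hφb hL' hφL

/-! ### Row sums -/

/-- Off the plaquette neighbourhood the influence count vanishes, so its row sum over ALL links `≠ e` is the
one over `linkNbrT e`, `≤ 6(d−1)`. [folklore] -/
theorem sum_erase_tInfluence_le (hd : 1 ≤ d) (hL : 1 < L) (e : Edge d L) :
    ∑ y ∈ univ.erase e, (tInfluence e y : ℝ) ≤ 6 * ((d : ℝ) - 1) := by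
  classical
  have hsub : linkNbrT e ⊆ univ.erase e := fun y hy =>
    Finset.mem_erase.2 ⟨(mem_linkNbrT_iff.1 hy).1, Finset.mem_univ _⟩
  rw [← Finset.sum_subset hsub fun y hy hyn => by
    rw [StarKernel.tInfluence_eq_jointPlaq hL (Finset.mem_erase.1 hy).1,
      StarKernel.jointPlaq_eq_zero_of_not_mem_linkNbrT (Finset.mem_erase.1 hy).1 hyn, Nat.cast_zero]]
  calc ∑ y ∈ linkNbrT e, (tInfluence e y : ℝ) = ((∑ y ∈ linkNbrT e, tInfluence e y : ℕ) : ℝ) := by push_cast; rfl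
    _ ≤ ((6 * (d - 1) : ℕ) : ℝ) := by exact_mod_cast sum_tInfluence_le e
    _ = 6 * ((d : ℝ) - 1) := by push_cast [Nat.cast_sub hd]; ring

/-- **Weighted influence row**: for `t ≥ 0`, `∑_{y ≠ e} n(e,y) e^{t‖e−y‖_∞} ≤ e^{t} · 6(d−1)` (plaquette neighbours
are at distance `≤ 1`). [folklore] -/
theorem sum_erase_tInfluence_mul_exp_le (hd : 1 ≤ d) (hL : 1 < L) {t : ℝ} (ht : 0 ≤ t) (e : Edge d L) :
    ∑ y ∈ univ.erase e, (tInfluence e y : ℝ) * Real.exp (t * torusNorm (e.1 - y.1)) ≤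
      Real.exp t * (6 * ((d : ℝ) - 1)) := by
  classical
  have hterm : ∀ y ∈ univ.erase e,
      (tInfluence e y : ℝ) * Real.exp (t * torusNorm (e.1 - y.1)) ≤ Real.exp t * tInfluence e y := by
    intro y hy
    by_cases hyn : y ∈ linkNbrT e
    · rw [mul_comm]
      refine mul_le_mul_of_nonneg_right (Real.exp_le_exp.2 ?_) (Nat.cast_nonneg _)
      calc t * (torusNorm (e.1 - y.1) : ℝ) ≤ t * 1 :=
            mul_le_mul_of_nonneg_left (by exact_mod_cast torusNorm_sub_le_one_of_mem_linkNbrT hyn) ht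
        _ = t := mul_one t
    · rw [StarKernel.tInfluence_eq_jointPlaq hL (Finset.mem_erase.1 hy).1,
        StarKernel.jointPlaq_eq_zero_of_not_mem_linkNbrT (Finset.mem_erase.1 hy).1 hyn]
      simp
  refine (Finset.sum_le_sum hterm).trans ?_
  rw [← Finset.mul_sum]
  exact mul_le_mul_of_nonneg_left (sum_erase_tInfluence_le hd hL e) (Real.exp_pos _).le

/-- **Weighted cross row**: for `t ≥ 0`, `∑_{y ≠ e} ℓ_0(e,y) e^{t‖e−y‖_∞} ≤ Λ_t(e)` (two links of a polymer `X` are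
at distance `≤ diam X`). [folklore] -/
theorem sum_erase_crossLip_mul_exp_le (w : LoadWitness W) {t : ℝ} (ht : 0 ≤ t) (e : Edge d L) :
    ∑ y ∈ univ.erase e, w.crossLip 0 e y * Real.exp (t * torusNorm (e.1 - y.1)) ≤ w.crossLipLoad t e := by
  unfold LoadWitness.crossLipLoad
  refine Finset.sum_le_sum fun y _ => ?_
  unfold LoadWitness.crossLip
  rw [Finset.sum_mul]
  refine Finset.sum_le_sum fun X hX => ?_
  obtain ⟨hXe, hXy⟩ := Finset.mem_filter.1 hX
  have heX : e.1 ∈ X := (mem_polymersThroughEdge.1 hXe).2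
  have hyX : y.1 ∈ X := mem_polymerEdges_one.1 hXy
  rw [zero_mul, Real.exp_zero, one_mul, mul_comm]
  refine mul_le_mul_of_nonneg_right (Real.exp_le_exp.2 (mul_le_mul_of_nonneg_left ?_ ht)) ((w.lip_spec X).nonneg y)
  exact_mod_cast torusNorm_sub_le_polymerDiam heX hyX

/-- **Row sum of the robust Dobrushin matrix**:
`∑_{y ≠ e} C_W(e,y) ≤ K e^{a(e)} (1 + 2√N ℓ_s(e)) (|β|/N) 6(d−1) + √N Λ(e)`. [folklore] -/
theorem sum_erase_robustEntry_le (hd : 1 ≤ d) (hL : 1 < L) {K : ℝ} (hK : 0 ≤ K) (β : ℝ) (w : LoadWitness W)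
    (e : Edge d L) :
    ∑ y ∈ univ.erase e, (K * Real.exp (w.oscLoad 0 e) * (1 + 2 * Real.sqrt N * w.selfLipLoad 0 e) * (|β| / N) *
        tInfluence e y + Real.sqrt N * w.crossLip 0 e y) ≤
      K * Real.exp (w.oscLoad 0 e) * (1 + 2 * Real.sqrt N * w.selfLipLoad 0 e) * (|β| / N) * (6 * ((d : ℝ) - 1)) +
        Real.sqrt N * w.crossLipLoad 0 e := by
  rw [Finset.sum_add_distrib, ← Finset.mul_sum, ← Finset.mul_sum]
  have hT : 0 ≤ K * Real.exp (w.oscLoad 0 e) * (1 + 2 * Real.sqrt N * w.selfLipLoad 0 e) * (|β| / N) :=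
    mul_nonneg (mul_nonneg (mul_nonneg hK (Real.exp_pos _).le)
      (add_nonneg zero_le_one (mul_nonneg (by positivity) (selfLipLoad_nonneg w 0 e)))) (by positivity)
  exact add_le_add (mul_le_mul_of_nonneg_left (sum_erase_tInfluence_le hd hL e) hT) le_rfl

/-- **Weighted row sum of the robust Dobrushin matrix** (`t ≥ 0`):
`∑_{y ≠ e} C_W(e,y) e^{t‖e−y‖_∞} ≤ e^{t} K e^{a(e)} (1 + 2√N ℓ_s(e)) (|β|/N) 6(d−1) + √N Λ_t(e)`. [folklore] -/
theorem sum_erase_robustEntry_mul_exp_le (hd : 1 ≤ d) (hL : 1 < L) {K : ℝ} (hK : 0 ≤ K) (β : ℝ) (w : LoadWitness W)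
    {t : ℝ} (ht : 0 ≤ t) (e : Edge d L) :
    ∑ y ∈ univ.erase e, (K * Real.exp (w.oscLoad 0 e) * (1 + 2 * Real.sqrt N * w.selfLipLoad 0 e) * (|β| / N) *
        tInfluence e y + Real.sqrt N * w.crossLip 0 e y) * Real.exp (t * torusNorm (e.1 - y.1)) ≤
      Real.exp t * K * Real.exp (w.oscLoad 0 e) * (1 + 2 * Real.sqrt N * w.selfLipLoad 0 e) * (|β| / N) *
          (6 * ((d : ℝ) - 1)) + Real.sqrt N * w.crossLipLoad t e := by
  have hT : 0 ≤ K * Real.exp (w.oscLoad 0 e) * (1 + 2 * Real.sqrt N * w.selfLipLoad 0 e) * (|β| / N) :=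
    mul_nonneg (mul_nonneg (mul_nonneg hK (Real.exp_pos _).le)
      (add_nonneg zero_le_one (mul_nonneg (by positivity) (selfLipLoad_nonneg w 0 e)))) (by positivity)
  have hsplit : ∀ y ∈ univ.erase e,
      (K * Real.exp (w.oscLoad 0 e) * (1 + 2 * Real.sqrt N * w.selfLipLoad 0 e) * (|β| / N) * tInfluence e y +
          Real.sqrt N * w.crossLip 0 e y) * Real.exp (t * torusNorm (e.1 - y.1)) =
        K * Real.exp (w.oscLoad 0 e) * (1 + 2 * Real.sqrt N * w.selfLipLoad 0 e) * (|β| / N) *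
            ((tInfluence e y : ℝ) * Real.exp (t * torusNorm (e.1 - y.1))) +
          Real.sqrt N * (w.crossLip 0 e y * Real.exp (t * torusNorm (e.1 - y.1))) := fun y _ => by ring
  rw [Finset.sum_congr rfl hsplit, Finset.sum_add_distrib, ← Finset.mul_sum, ← Finset.mul_sum]
  refine add_le_add ?_ (mul_le_mul_of_nonneg_left (sum_erase_crossLip_mul_exp_le w ht e) (Real.sqrt_nonneg _))
  calc K * Real.exp (w.oscLoad 0 e) * (1 + 2 * Real.sqrt N * w.selfLipLoad 0 e) * (|β| / N) *
          ∑ y ∈ univ.erase e, (tInfluence e y : ℝ) * Real.exp (t * torusNorm (e.1 - y.1))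
      ≤ K * Real.exp (w.oscLoad 0 e) * (1 + 2 * Real.sqrt N * w.selfLipLoad 0 e) * (|β| / N) *
          (Real.exp t * (6 * ((d : ℝ) - 1))) :=
        mul_le_mul_of_nonneg_left (sum_erase_tInfluence_mul_exp_le hd hL ht e) hT
    _ = _ := by ring

/-- **The vertex bound.** The row sum `e^{a}(1 + 2√N ℓ_s) c_W + √N Λ` is affine in `(ℓ_s, Λ) ≥ 0`, so on
`a ≤ ε₀`, `ℓ_s + Λ ≤ ε₁` it is at most its larger value at the two vertices `(ε₁, 0)`, `(0, ε₁)`: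
`≤ rhoFR N c_W ε₀ ε₁ = max(e^{ε₀}(1 + 2√N ε₁) c_W, e^{ε₀} c_W + √N ε₁)`. [folklore] -/
theorem row_le_rhoFR {cW a ℓs Λ ε₀ ε₁ : ℝ} (hcW : 0 ≤ cW) (ha : a ≤ ε₀) (hℓs : 0 ≤ ℓs) (hΛ : 0 ≤ Λ)
    (hsum : ℓs + Λ ≤ ε₁) :
    Real.exp a * (1 + 2 * Real.sqrt N * ℓs) * cW + Real.sqrt N * Λ ≤ rhoFR N cW ε₀ ε₁ := by
  unfold rhoFR
  set A : ℝ := Real.exp ε₀ * cW with hA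
  have hA0 : 0 ≤ A := mul_nonneg (Real.exp_pos _).le hcW
  have hN0 : 0 ≤ Real.sqrt (N : ℝ) := Real.sqrt_nonneg _
  have hε₁ : 0 ≤ ε₁ := le_trans (add_nonneg hℓs hΛ) hsum
  have hea : Real.exp a ≤ Real.exp ε₀ := Real.exp_le_exp.2 ha
  -- replace `e^{a}` by `e^{ε₀}`
  have h1 : Real.exp a * (1 + 2 * Real.sqrt N * ℓs) * cW + Real.sqrt N * Λ ≤
      A + (2 * Real.sqrt N * A) * ℓs + Real.sqrt N * Λ := by
    have : Real.exp a * (1 + 2 * Real.sqrt N * ℓs) * cW ≤ Real.exp ε₀ * (1 + 2 * Real.sqrt N * ℓs) * cW :=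
      mul_le_mul_of_nonneg_right (mul_le_mul_of_nonneg_right hea (by positivity)) hcW
    rw [hA]; nlinarith
  -- both slopes are at most `M = max (2√N A) √N`
  set M : ℝ := max (2 * Real.sqrt N * A) (Real.sqrt N) with hM
  have h2 : (2 * Real.sqrt N * A) * ℓs + Real.sqrt N * Λ ≤ M * ε₁ := by
    calc (2 * Real.sqrt N * A) * ℓs + Real.sqrt N * Λ ≤ M * ℓs + M * Λ :=
          add_le_add (mul_le_mul_of_nonneg_right (le_max_left _ _) hℓs)
            (mul_le_mul_of_nonneg_right (le_max_right _ _) hΛ)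
      _ = M * (ℓs + Λ) := by ring
      _ ≤ M * ε₁ := mul_le_mul_of_nonneg_left hsum (le_trans hN0 (le_max_right _ _))
  have h3 : A + M * ε₁ ≤ max (Real.exp ε₀ * (1 + 2 * Real.sqrt N * ε₁) * cW) (Real.exp ε₀ * cW + Real.sqrt N * ε₁) := by
    rcases le_total (2 * Real.sqrt N * A) (Real.sqrt N) with hle | hle
    · rw [hM, max_eq_right hle]
      exact le_max_of_le_right (by rw [hA])
    · rw [hM, max_eq_left hle]
      refine le_max_of_le_left (le_of_eq ?_)
      rw [hA]; ring
  linarith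

/-! ### The door targets -/

/-- A member of the tier-1 ball has per-link loads `a(e) ≤ ε₀`, `ℓ_s(e) + Λ(e) ≤ ε₁` for SOME witness; this
unpacks the membership. [folklore] -/
theorem exists_witness_of_mem_clusterDomainFR {ε₀ ε₁ : ℝ} {r : ℕ} (hW : W ∈ ClusterDomainFR ε₀ ε₁ r) :
    HasRange r W ∧ ∃ w : LoadWitness W, (∀ e, w.oscLoad 0 e ≤ ε₀) ∧ (∀ e, w.selfLipLoad 0 e + w.crossLipLoad 0 e ≤ ε₁) :=
  hW

/-- **U3 — THE ROBUST TORUS DOOR (tier 1)** from ANY one-link modulus `OneLinkKRModulus N R K` on the radius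
`R ≥ (|β|/N) 2(d−1)`: on every torus `L ≥ 3`, every member of `ClusterDomainFR ε₀ ε₁ r` is a KR contraction over
neighbourhoods of range `≤ r ⊔ 1` with row sums `≤ rhoFR N (K (|β|/N) 6(d−1)) ε₀ ε₁` (`d ≥ 1`, `N ≥ 1`). [folklore] -/
theorem robustTorusDoorTarget_holds (hd : 1 ≤ d) (hN : 1 ≤ N) (β ε₀ ε₁ R K : ℝ) (r : ℕ) :
    RobustTorusDoorTarget N d β ε₀ ε₁ R K r := by
  intro hK hR hmod hε₀ _hε₁ L _ hL W hW
  obtain ⟨hr, w, hwa, hwℓ⟩ := exists_witness_of_mem_clusterDomainFR hW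
  have hL1 : 1 < L := by omega
  refine ⟨fun e => (univ.erase e).filter fun y => torusNorm (e.1 - y.1) ≤ max r 1, _,
    isKRContraction_perturbedTorusSpec_of_hasRange hd hN hL1 hK hR hmod w hr, fun e => ?_, fun e y hy => ?_⟩
  · refine le_trans (Finset.sum_le_sum_of_subset_of_nonneg (Finset.filter_subset _ _)
      fun y _ _ => robustEntry_nonneg hK β w e y) ?_
    refine (sum_erase_robustEntry_le hd hL1 hK β w e).trans ?_
    have hd1 : (0 : ℝ) ≤ (d : ℝ) - 1 := by
      have : (1 : ℝ) ≤ d := by exact_mod_cast hd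
      linarith
    have hcW : 0 ≤ K * (|β| / N) * (6 * ((d : ℝ) - 1)) := by positivity
    have key := row_le_rhoFR (N := N) hcW (hwa e) (selfLipLoad_nonneg w 0 e) (crossLipLoad_nonneg w 0 e) (hwℓ e)
    calc K * Real.exp (w.oscLoad 0 e) * (1 + 2 * Real.sqrt N * w.selfLipLoad 0 e) * (|β| / N) * (6 * ((d : ℝ) - 1)) +
          Real.sqrt N * w.crossLipLoad 0 e
        = Real.exp (w.oscLoad 0 e) * (1 + 2 * Real.sqrt N * w.selfLipLoad 0 e) * (K * (|β| / N) * (6 * ((d : ℝ) - 1))) +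
          Real.sqrt N * w.crossLipLoad 0 e := by ring
      _ ≤ _ := key
  · exact (Finset.mem_filter.1 hy).2

/-- A member of the tier-2 ball has weighted per-link loads bounded for SOME witness; this unpacks it. [folklore] -/
theorem exists_witness_of_mem_clusterDomain {κ ε₀ ε₁ : ℝ} (hW : W ∈ ClusterDomain κ ε₀ ε₁) :
    ∃ w : LoadWitness W, (∀ e, w.oscLoad κ e ≤ ε₀) ∧ (∀ e, w.selfLipLoad κ e + w.crossLipLoad κ e ≤ ε₁) :=
  hW

/-- **U3-W — THE ROBUST TORUS DOOR (tier 2, weighted rows)**: on every torus `L ≥ 3`, every member of the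
diameter-weighted ball `ClusterDomain κ ε₀ ε₁` (`κ ≥ 0`) is a KR contraction over all links with rows weighted by
`e^{κ‖e−y‖_∞}` at most `rhoFR N (e^{κ} K (|β|/N) 6(d−1)) ε₀ ε₁` — the hypothesis `hroww` of lit-1's weighted
Dobrushin engine (`d ≥ 1`, `N ≥ 1`). [folklore] -/
theorem robustTorusDoorWTarget_holds (hd : 1 ≤ d) (hN : 1 ≤ N) (β κ ε₀ ε₁ R K : ℝ) :
    RobustTorusDoorWTarget N d β κ ε₀ ε₁ R K := by
  intro hK hκ hR hmod hε₀ _hε₁ L _ hL W hW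
  obtain ⟨w, hwa, hwℓ⟩ := exists_witness_of_mem_clusterDomain hW
  have hL1 : 1 < L := by omega
  refine ⟨fun e => univ.erase e, _, isKRContraction_perturbedTorusSpec hd hN hL1 hK hR hmod w, fun e => ?_⟩
  refine (sum_erase_robustEntry_mul_exp_le hd hL1 hK β w hκ e).trans ?_
  have hd1 : (0 : ℝ) ≤ (d : ℝ) - 1 := by
    have : (1 : ℝ) ≤ d := by exact_mod_cast hd
    linarith
  have hcW : 0 ≤ Real.exp κ * K * (|β| / N) * (6 * ((d : ℝ) - 1)) := by positivity
  have key := row_le_rhoFR (N := N) hcW ((oscLoad_zero_le w hκ e).trans (hwa e))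
    (selfLipLoad_nonneg w 0 e) (crossLipLoad_nonneg w κ e)
    (le_trans (add_le_add (selfLipLoad_zero_le w hκ e) le_rfl) (hwℓ e))
  calc Real.exp κ * K * Real.exp (w.oscLoad 0 e) * (1 + 2 * Real.sqrt N * w.selfLipLoad 0 e) * (|β| / N) *
          (6 * ((d : ℝ) - 1)) + Real.sqrt N * w.crossLipLoad κ e
      = Real.exp (w.oscLoad 0 e) * (1 + 2 * Real.sqrt N * w.selfLipLoad 0 e) *
          (Real.exp κ * K * (|β| / N) * (6 * ((d : ℝ) - 1))) + Real.sqrt N * w.crossLipLoad κ e := by ring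
    _ ≤ _ := key

end Door

end Summit.Ventures.YMGap.RobustBall

end
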